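import Literature.AlgebraicGeometry.Resolution.AlterationsStableModelParts
import Literature.AlgebraicGeometry.Resolution.AlterationsStableModelSmoothOpen
import Literature.AlgebraicGeometry.Resolution.AlterationsLemma411
import Literature.AlgebraicGeometry.Resolution.AlterationsGraphClosureProofs
import Literature.AlgebraicGeometry.Resolution.AlterationsRationalMapExtension
import Literature.AlgebraicGeometry.Resolution.FibresOfBaseChange
import Literature.AlgebraicGeometry.Resolution.BaseChangeOverOpens
import Literature.AlgebraicGeometry.Resolution.FiniteCoverCompactification
import Literature.AlgebraicGeometry.Resolution.GraphClosureCompactification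
import Literature.AlgebraicGeometry.Resolution.PointedModelChart
import Mathlib.AlgebraicGeometry.Geometrically.Connected
import HarnessLib

/-!
# De Jong 1996, 4.17 PROVED from its moduli input 2.24: the stable extension over an alteration

Topic: `Literature/AlgebraicGeometry/Resolution`. The named fact `DeJong1996StableExtension`
(`AlterationsStableModelParts.lean`) is de Jong 1996, 4.17 together with its input 2.24 (the
moduli of stable pointed curves with level structure). This file separates the two: it PROVES
the construction of 4.17 —

> "4.17. Assume (i)–(iv), (vi) a)–f). We define an open subscheme `U ⊂ Y` by the formula
> `U = {y ∈ Y | X_y is smooth over y and σᵢ(y) ≠ σⱼ(y) for i ≠ j}`. By (vi) c) we have `U ≠ ∅`.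
> Let `g` denote the genus of `f⁻¹(y)` for `y ∈ U`. In view of (vi) e) we have `n ≥ 3` (with
> `n` as in (vi) f)), hence `(X_U, σ₁|_U, …, σₙ|_U)` is a stable `n`-pointed curve of genus `g`
> over `U`. This defines a 1-morphism `U → M_{g,n}` […]. Let `U' ⊂ U ×_{M_{g,n}} ℓM_{g,n}` be
> an irreducible component; it is finite étale over `U`, nonempty […]. Put `Y'` equal to the
> closure of `Im(U' → Y ×_k ℓM̄_{g,n})`. It is clear that `Y'` is a projective variety over `k`
> and that `ψ : Y' → Y` is an alteration which is generically étale. The smooth stable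
> `n`-pointed curve `(X_U, σ₁|_U, …, σₙ|_U) ×_U U'` extends to a stable `n`-pointed curve over
> `Y'`, see 2.24. (The 1-morphism `U' → U → M_{g,n}` extends to
> `Y' → ℓM̄_{g,n} → M̄_{g,n}[1/ℓ] → M̄_{g,n}` by construction.)" (pp. 71–72)

— from an explicit hypothesis isolating exactly what 2.24 supplies to it, in the family-wise
form in which the text uses it (no algebraic stacks in Mathlib): **for every smooth `n`-pointed
(`n ≥ 3`) proper curve family `(X_U → U, σ)` with geometrically connected one-dimensional fibres
and pairwise disjoint sections over an integral `k`-scheme `U` of finite type, there are a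
projective `k`-scheme `M̄` carrying a pointed semi-stable curve `(𝒞 → M̄, τ)` with `𝒞`
projective over `k` ("`ℓM̄_{g,n}` is a projective scheme […] we get a 'universal' stable
`n`-pointed curve of genus `g` over `ℓM̄_{g,n}`", 2.24), an integral scheme `U'` with a finite
surjective generically étale `U' → U` ("an irreducible component; it is finite étale over `U`,
nonempty") and a `k`-morphism `U' → M̄` along which `(𝒞, τ)` pulls back to `(X_U, σ) ×_U U'`**
(the hypothesis `h224` of `DeJong1996StableExtension.of_moduli`; "stable `n`-pointed" is weakened
to pointed semi-stable as everywhere in the tree, and étaleness of `U' → U` to generic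
étaleness, which is all 4.17 uses).

The proof is the printed one: the open `U` (generic smoothness (vi) c),
`DeJong1996.FibredPair.exists_smooth_morphismRestrict`; pairwise distinctness of the `σᵢ` at the
generic point, `DeJong1996.exists_opens_pairwise_ne`); `n ≥ 3` from (vi) e)
(`DeJong1996.three_le_of_hasThreeSmoothPoints`: each `σᵢ` meets a geometric fibre in one point);
the compactification `Y'` of `U'` over `Y ×_k M̄` — here: `U'` is an open of the normalization
`N` of `Y` in `U'`, finite over `Y` (E. Noether; `FiniteCoverCompactification.lean`), and `Y'` is
the closure of the graph of `U' → M̄` in `N ×_k M̄` (`GraphClosureCompactification.lean`), a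
projective variety with `ψ⁻¹(U) = U'`, so that `ψ` is a generically étale alteration; and the
model `𝒞 ×_{M̄} Y'` — a pointed semi-stable curve (base change), integral (flat over `Y'` with
reduced fibres and smooth generic fibre, Liu 2002, 4.3.8) and projective over `k` (Segre),
isomorphic to `X ×_Y Y'` over `U' ⊆ Y'` with matching sections (`PointedModelChart.lean`).

No new named fact is introduced; 2.24 itself (Knudsen [16], Deligne [6]: `ℓM_{g,n}` is a scheme
finite étale over `M_{g,n}[1/ℓ]`, `ℓM̄_{g,n}` is projective with a universal stable `n`-pointed
curve) remains the open input, now as the hypothesis `h224`.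

## References

* A. J. de Jong, *Smoothness, semi-stability and alterations*, Publ. Math. IHÉS 83 (1996), 2.24
  (p. 62), 4.17 (pp. 71–72). [DeJong1996]
* F. Knudsen, *The projectivity of the moduli space of stable curves II, III*, Math. Scand. 52
  (1983). [Knudsen1983]
* P. Deligne, *Le lemme de Gabber*, Astérisque 127 (1985), 131–150. [Deligne1985]
* Q. Liu, *Algebraic Geometry and Arithmetic Curves* (2002), Prop. 4.3.8. [Liu2002]
-/

noncomputable section

open CategoryTheory CategoryTheory.Limits AlgebraicGeometry TopologicalSpace Topology

namespace Literature.AlgebraicGeometry.Resolution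

universe u

namespace DeJong1996

/-! ## "`σᵢ(y) ≠ σⱼ(y) for i ≠ j`": the open of pairwise distinct sections -/

section DistinctSections

variable {X Y : Scheme.{u}} {f : X ⟶ Y} {n : ℕ} {σ : Fin n → (Y ⟶ X)}
  (hσ : ∀ i, σ i ≫ f = 𝟙 Y)

include hσ in
/-- Two sections of `f` agree at `y` iff `σⱼ(y)` lies on `σᵢ(Y)`. [folklore] -/
theorem setOf_apply_eq_apply (i j : Fin n) :
    {y : Y | σ i y = σ j y} = σ j ⁻¹' Set.range (σ i) := by
  ext y
  constructor
  · intro h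
    exact ⟨y, h⟩
  · rintro ⟨y', h⟩
    have h1 : (σ i ≫ f) y' = (σ j ≫ f) y := by
      rw [Scheme.Hom.comp_apply, Scheme.Hom.comp_apply, h]
    rw [hσ i, hσ j] at h1
    have h2 : y' = y := by simpa using h1
    subst h2
    exact h

include hσ in
/-- The locus where two sections of a separated morphism agree is closed. [folklore] -/
theorem isClosed_setOf_apply_eq_apply [IsSeparated f] (i j : Fin n) :
    IsClosed {y : Y | σ i y = σ j y} := by
  rw [setOf_apply_eq_apply hσ i j]
  haveI := IsUnionOfSections.isClosedImmersion_of_comp_eq_id (hσ i)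
  exact (σ i).isClosedEmbedding.isClosed_range.preimage (σ j).continuous

include hσ in
/-- **Distinct sections of a separated morphism over a reduced base are distinct at some point**:
if `σⱼ(Y) ⊆ σᵢ(Y)` then `σⱼ` factors through the closed immersion `σᵢ` (the base being
reduced), and the factor is `σⱼ ≫ f = 𝟙`. [folklore] -/
theorem exists_apply_ne_apply [IsSeparated f] [IsReduced Y] (hinj : Function.Injective σ)
    {i j : Fin n} (hij : i ≠ j) : ∃ y : Y, σ i y ≠ σ j y := by
  by_contra! h
  have hr : Set.range (σ j) ⊆ Set.range (σ i) := by
    rintro _ ⟨y, rfl⟩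
    exact ⟨y, h y⟩
  haveI := IsUnionOfSections.isClosedImmersion_of_comp_eq_id (hσ i)
  have hφ : IsClosedImmersion.liftOfRange (σ i) (σ j) hr ≫ σ i = σ j :=
    IsClosedImmersion.liftOfRange_fac _ _ _
  have hφ1 : IsClosedImmersion.liftOfRange (σ i) (σ j) hr = 𝟙 Y := by
    have h2 := congrArg (· ≫ f) hφ
    simp only [Category.assoc, hσ i, hσ j, Category.comp_id] at h2
    exact h2
  rw [hφ1, Category.id_comp] at hφ
  exact hij (hinj hφ)

include hσ in
/-- **Distinct sections are distinct at the generic point** of an integral base (the locus of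
agreement is closed and not everything). [folklore] -/
theorem apply_genericPoint_ne [IsSeparated f] [IsIntegral Y] (hinj : Function.Injective σ)
    {i j : Fin n} (hij : i ≠ j) : σ i (genericPoint Y) ≠ σ j (genericPoint Y) := by
  intro h
  obtain ⟨y, hy⟩ := exists_apply_ne_apply hσ hinj hij
  have hsub := ((genericPoint_spec Y).mem_closed_set_iff
    (isClosed_setOf_apply_eq_apply hσ i j)).mp h
  exact hy (hsub (Set.mem_univ y))

include hσ in
/-- **The open `{y | σᵢ(y) ≠ σⱼ(y) for i ≠ j}` of 4.17 is a non-empty open** (it contains the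
generic point) for pairwise distinct sections `σᵢ` of a separated `f` over an integral `Y`.
[cite: DeJong1996, 4.17, p. 71] -/
theorem exists_opens_pairwise_ne [IsSeparated f] [IsIntegral Y] (hinj : Function.Injective σ) :
    ∃ U₁ : Y.Opens, genericPoint Y ∈ U₁ ∧ ∀ y ∈ U₁, ∀ i j, i ≠ j → σ i y ≠ σ j y := by
  have ho : IsOpen {y : Y | ∀ i j, i ≠ j → σ i y ≠ σ j y} := by
    have he : {y : Y | ∀ i j, i ≠ j → σ i y ≠ σ j y} =
        ⋂ i, ⋂ j, {y : Y | i ≠ j → σ i y ≠ σ j y} := by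
      ext y
      simp only [Set.mem_setOf_eq, Set.mem_iInter]
    rw [he]
    refine isOpen_iInter_of_finite fun i => isOpen_iInter_of_finite fun j => ?_
    by_cases hij : i = j
    · have : {y : Y | i ≠ j → σ i y ≠ σ j y} = Set.univ := by
        ext y
        simp [hij]
      rw [this]
      exact isOpen_univ
    · have : {y : Y | i ≠ j → σ i y ≠ σ j y} = {y : Y | σ i y = σ j y}ᶜ := by
        ext y
        simp [hij]
      rw [this]
      exact (isClosed_setOf_apply_eq_apply hσ i j).isOpen_compl
  exact ⟨⟨_, ho⟩, fun i j hij => apply_genericPoint_ne hσ hinj hij, fun y hy => hy⟩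

end DistinctSections

/-! ## "In view of (vi) e) we have `n ≥ 3`" -/

/-- **(vi) e) forces `n ≥ 3`** when `Z = ⋃ᵢ σᵢ(Y)`: in a geometric fibre `X_ȳ` (non-empty, `f`
being surjective) the preimage of `Z` is the set of the `n` points `σᵢ(ȳ)`, and an irreducible
component of `X_ȳ` carries at least three of its points. [cite: DeJong1996, 4.17, p. 71] -/
theorem three_le_of_hasThreeSmoothPoints {X Y : Scheme.{u}} (f : X ⟶ Y)
    [LocallyOfFinitePresentation f] [Surjective f] [Nonempty Y] {n : ℕ} {σ : Fin n → (Y ⟶ X)}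
    (hσ : ∀ i, σ i ≫ f = 𝟙 Y) (h3 : HasThreeSmoothPoints f (⋃ i, Set.range (σ i))) :
    3 ≤ n := by
  classical
  obtain ⟨y⟩ := (inferInstance : Nonempty Y)
  let K : Type u := AlgebraicClosure (Y.residueField y)
  let ybar : Spec (.of K) ⟶ Y :=
    Spec.map (CommRingCat.ofHom (algebraMap (Y.residueField y) K)) ≫ Y.fromSpecResidueField y
  obtain ⟨z, -⟩ := (pullback.snd f ybar).surjective (IsLocalRing.closedPoint K)
  have hC := irreducibleComponent_mem_irreducibleComponents z
  have h := h3 K ybar _ hC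
  -- the preimage of `Z` in the geometric fibre consists of the `n` points `σᵢ(ȳ)`
  have hZ : pullback.fst f ybar ⁻¹' (⋃ i, Set.range (σ i)) ⊆
      Set.range (fun i => PreSemiStablePair.pullbackSection hσ ybar i
        (IsLocalRing.closedPoint K)) := by
    rw [IsUnionOfSections.preimage_fst_iUnion_range hσ ybar]
    rintro x hx
    obtain ⟨i, ⟨t, rfl⟩⟩ := Set.mem_iUnion.mp hx
    obtain rfl : t = IsLocalRing.closedPoint K := Subsingleton.elim (α := PrimeSpectrum K) _ _
    exact ⟨i, rfl⟩
  have hle : (irreducibleComponent z ∩ pullback.fst f ybar ⁻¹'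
      ((f.smoothLocus : Set X) ∩ ⋃ i, Set.range (σ i))).encard ≤ (n : ℕ∞) := by
    refine (Set.encard_le_encard ?_).trans ((Set.encard_le_encard hZ).trans ?_)
    · intro x hx
      exact hx.2.2
    · rw [← Set.image_univ]
      refine (Set.encard_image_le _ _).trans ?_
      rw [Set.encard_univ, ENat.card_eq_coe_fintype_card, Fintype.card_fin]
  exact_mod_cast h.trans hle

/-! ## The fibres of the restriction of `f` over an open -/

/-- The fibre of `f|_U : f⁻¹(U) → U` at `y ∈ U` is homeomorphic to the fibre of `f` at `y`.
[folklore] -/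
theorem nonempty_homeomorph_fiber_morphismRestrict {X Y : Scheme.{u}} (f : X ⟶ Y) (U : Y.Opens)
    (y : U) : Nonempty (↥((f ∣_ U).fiber y) ≃ₜ ↥(f.fiber y.1)) := by
  let mid : ((f ∣_ U) ⁻¹' {y} : Set ↥(f ⁻¹ᵁ U)) ≃ₜ (f ⁻¹' {y.1} : Set X) :=
    { toFun := fun x => ⟨x.1.1, by
        have hx : (f ∣_ U) x.1 = y := x.2
        have := morphismRestrict_base_coe f U x.1
        rw [hx] at this
        exact this.symm⟩
      invFun := fun z => ⟨⟨z.1, show f z.1 ∈ U by rw [show f z.1 = y.1 from z.2]; exact y.2⟩,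
        Subtype.ext (by rw [morphismRestrict_base_coe]; exact z.2)⟩
      left_inv := fun x => rfl
      right_inv := fun z => rfl
      continuous_toFun := by fun_prop
      continuous_invFun := by fun_prop }
  exact ⟨((f ∣_ U).fiberHomeo y).trans (mid.trans (f.fiberHomeo y.1).symm)⟩

/-- **Equidimensionality of the fibres restricts to opens**: if every irreducible component of
every fibre of `f` has dimension `d`, the same holds for `f|_U`. [folklore] -/
theorem topologicalKrullDim_irreducibleComponents_fiber_morphismRestrict {X Y : Scheme.{u}}
    (f : X ⟶ Y) (U : Y.Opens) {d : WithBot ℕ∞}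
    (hf : ∀ (y : Y), ∀ C ∈ irreducibleComponents ↥(f.fiber y), topologicalKrullDim C = d)
    (y : U) :
    ∀ C ∈ irreducibleComponents ↥((f ∣_ U).fiber y), topologicalKrullDim C = d := by
  obtain ⟨e⟩ := nonempty_homeomorph_fiber_morphismRestrict f U y
  exact IsHomeomorph.topologicalKrullDim_irreducibleComponents e.isHomeomorph (hf y.1)

/-! ## Projectivity of finite covers -/

/-- **A scheme finite over a projective `k`-scheme is projective over `k`** (Görtz–Wedhorn I,
Thm. 13.84 with Cor. 13.72, `Motives.isProjectiveOver_of_isFinite`: `Z → Y ↪ ℙⁿ_k` is finite and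
`Z` is proper over `k`). [folklore] -/
theorem isProjectiveOver_comp_of_isFinite {k : Type u} [Field k] {Z Y : Scheme.{u}} (ν : Z ⟶ Y)
    [IsFinite ν] (g : Y ⟶ Spec (.of k)) (hproj : Motives.IsProjectiveOver (Over.mk g)) :
    Motives.IsProjectiveOver (Over.mk (ν ≫ g)) := by
  haveI : IsProper g := Motives.IsProjectiveOver.isProper hproj
  obtain ⟨m, ι, hι⟩ := hproj
  let ι' : Y ⟶ (Motives.projectiveSpace m k).left := ι.left
  haveI : IsClosedImmersion ι' := hι
  have hg : ι' ≫ (Motives.projectiveSpace m k).hom = g := Over.w ι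
  haveI : IsProper (Over.mk (ν ≫ g) : Motives.SchemeOver k).hom :=
    inferInstanceAs (IsProper (ν ≫ g))
  have hw : (ν ≫ ι') ≫ (Motives.projectiveSpace m k).hom =
      (Over.mk (ν ≫ g) : Motives.SchemeOver k).hom := by
    rw [Category.assoc, hg]
    rfl
  haveI : IsFinite (Over.homMk (ν ≫ ι') hw :
      (Over.mk (ν ≫ g) : Motives.SchemeOver k) ⟶ Motives.projectiveSpace m k).left :=
    inferInstanceAs (IsFinite (ν ≫ ι'))
  exact Motives.isProjectiveOver_of_isFinite (Over.homMk (ν ≫ ι') hw)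

/-! ## Restricting a morphism property along isomorphic cartesian squares -/

/-- If `W → V` is the pullback of `p : C → Y` along an open immersion `j : V → Y`, a property of
morphisms respecting isomorphisms passes from `W → V` to the restriction `p|_{j(V)}`.
[folklore] -/
theorem morphismRestrict_opensRange_of_isPullback (P : MorphismProperty Scheme.{u})
    [P.RespectsIso] {C Y V W : Scheme.{u}} (p : C ⟶ Y) (j : V ⟶ Y) [IsOpenImmersion j]
    (r : W ⟶ V) (w : W ⟶ C) (h : IsPullback w r p j) (hr : P r) : P (p ∣_ j.opensRange) := by
  obtain ⟨φ, -, hφ⟩ := exists_iso_preimage_of_isPullback p j r w h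
  have e : p ∣_ j.opensRange = φ.inv ≫ r ≫ j.isoOpensRange.hom := by
    rw [Iso.eq_inv_comp, hφ]
  rw [e, P.cancel_left_of_respectsIso, P.cancel_right_of_respectsIso]
  exact hr

end DeJong1996

/-! ## 4.17 from 2.24 -/

open DeJong1996 in
/-- **de Jong 1996, 4.17 PROVED from its moduli input 2.24.** The hypothesis `h224` is 2.24 as
4.17 uses it, family-wise: for every algebraically closed `k`, every integral `k`-scheme `U` of
finite type and every smooth proper `p₀ : X₀ → U` with geometrically connected fibres all of
whose irreducible components are curves, with `n ≥ 3` pairwise disjoint sections `σ₀ᵢ` — a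
smooth stable `n`-pointed curve over `U` — there are: a projective `k`-scheme `M̄` (in the text
`ℓM̄_{g,n} ⊗ k`, "a projective scheme", 2.24) with a pointed semi-stable curve `(q : 𝒞 → M̄, τ)`,
`𝒞` projective over `k` (the "universal" stable `n`-pointed curve, 2.24); an integral `U'` with
a finite surjective generically étale `e : U' → U` ("an irreducible component of
`U ×_{M_{g,n}} ℓM_{g,n}`; it is finite étale over `U`, nonempty", 4.17) and a `k`-morphism
`m : U' → M̄` (`U' → ℓM_{g,n} ⊆ ℓM̄_{g,n}`); and a scheme `X'` over `U'` which is the pullback both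
of `p₀` along `e` and of `q` along `m`, with sections `ρᵢ` lifting `σ₀ᵢ ∘ e` and `τᵢ ∘ m` (the
universal property of the universal curve: `(X_U, σ) ×_U U' ≅ 𝒞 ×_{M̄} U'`). CONCLUSION: the
named fact `DeJong1996StableExtension` (4.17 with 2.24). Proof as printed (see the module
docstring): the open `U` of 4.17, `n ≥ 3` by (vi) e), `Y'` = the closure of the graph of `m` in
`N ×_k M̄` for the normalization `N` of `Y` in `U'` (finite over `Y` by E. Noether, so that `Y'`
is a projective variety and `ψ : Y' → Y` a generically étale alteration with `ψ⁻¹(U) = U'`), and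
the model `𝒞 ×_{M̄} Y'`. [cite: DeJong1996, 4.17 with 2.24, pp. 62, 71–72] -/
theorem DeJong1996StableExtension.of_moduli
    (h224 : ∀ (k : Type u) [Field k] [IsAlgClosed k] ⦃U X₀ : Scheme.{u}⦄ [IsIntegral U]
      (gU : U ⟶ Spec (.of k)) [LocallyOfFiniteType gU] [CompactSpace U]
      (p₀ : X₀ ⟶ U) [Smooth p₀] [IsProper p₀] [GeometricallyConnected p₀],
      (∀ (y : U), ∀ C ∈ irreducibleComponents ↥(p₀.fiber y), topologicalKrullDim C = 1) →
      ∀ ⦃n : ℕ⦄, 3 ≤ n → ∀ (σ₀ : Fin n → (U ⟶ X₀)), (∀ i, σ₀ i ≫ p₀ = 𝟙 U) →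
      (Pairwise fun i j => Disjoint (Set.range (σ₀ i)) (Set.range (σ₀ j))) →
      ∃ (M : Scheme.{u}) (gM : M ⟶ Spec (.of k)) (CM : Scheme.{u}) (q : CM ⟶ M)
        (τ : Fin n → (M ⟶ CM)) (U' : Scheme.{u}) (_ : IsIntegral U') (e : U' ⟶ U)
        (m : U' ⟶ M) (X' : Scheme.{u}) (p' : X' ⟶ U') (a : X' ⟶ X₀) (b : X' ⟶ CM)
        (ρ : Fin n → (U' ⟶ X')),
        Motives.IsProjectiveOver (Over.mk gM) ∧ Motives.IsProjectiveOver (Over.mk (q ≫ gM)) ∧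
        IsPointedSemiStableCurve q τ ∧ IsFinite e ∧ Surjective e ∧ IsGenericallyEtale e ∧
        m ≫ gM = e ≫ gU ∧ IsPullback a p' p₀ e ∧ IsPullback b p' q m ∧
        ∀ i, ρ i ≫ p' = 𝟙 U' ∧ ρ i ≫ a = e ≫ σ₀ i ∧ ρ i ≫ b = m ≫ τ i) :
    DeJong1996StableExtension.{u} := by
  intro k _ _ X Y _ f _ g Z n σ hσ hP h3 hinj hZ
  classical
  /- instances on `f`, `g`, `Y` -/
  haveI : IsProper f := hP.isProper_fibration
  haveI hgproper : IsProper g := Motives.IsProjectiveOver.isProper (X := Over.mk g)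
    hP.isProjectiveOver_base
  haveI : IsLocallyNoetherian Y := isLocallyNoetherian_of_locallyOfFiniteType_field g
  haveI : CompactSpace Y := by
    rw [← isCompact_univ_iff, ← Set.preimage_univ (f := g)]
    exact QuasiCompact.isCompact_preimage (f := g) _ isOpen_univ isCompact_univ
  haveI : IsNoetherian Y := ⟨⟩
  haveI : Surjective f := hP.isCurveFibration.surjective
  haveI : GeometricallyConnected f := hP.isCurveFibration.geometricallyConnected
  /- Step 1: the open `U₀` of 4.17 -/
  obtain ⟨V, hηV, hVsm⟩ := hP.exists_smooth_morphismRestrict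
  obtain ⟨U₁, hηU₁, hU₁⟩ := exists_opens_pairwise_ne hσ hinj
  let U₀ : Y.Opens := V ⊓ U₁
  have hηU₀ : genericPoint Y ∈ U₀ := ⟨hηV, hηU₁⟩
  haveI : Nonempty U₀ := ⟨⟨_, hηU₀⟩⟩
  haveI : Smooth (f ∣_ U₀) := smooth_morphismRestrict_of_le f inf_le_left
  haveI : IsProper (f ∣_ U₀) := MorphismProperty.of_isPullback
    (isPullback_morphismRestrict f U₀).flip inferInstance
  haveI : CompactSpace U₀ := isCompact_iff_compactSpace.mp (NoetherianSpace.isCompact _)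
  -- the restricted sections
  have hrange : ∀ i, Set.range (U₀.ι ≫ σ i) ⊆ Set.range (f ⁻¹ᵁ U₀).ι := by
    intro i
    rw [Scheme.Opens.range_ι]
    rintro _ ⟨u, rfl⟩
    show f ((U₀.ι ≫ σ i) u) ∈ U₀
    rw [← Scheme.Hom.comp_apply, Category.assoc, hσ i, Category.comp_id]
    exact u.2
  let σ₀ : Fin n → ((U₀ : Scheme.{u}) ⟶ (f ⁻¹ᵁ U₀ : X.Opens)) := fun i =>
    IsOpenImmersion.lift (f ⁻¹ᵁ U₀).ι (U₀.ι ≫ σ i) (hrange i)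
  have hσ₀ι : ∀ i, σ₀ i ≫ (f ⁻¹ᵁ U₀).ι = U₀.ι ≫ σ i := fun i => IsOpenImmersion.lift_fac _ _ _
  have hσ₀ : ∀ i, σ₀ i ≫ (f ∣_ U₀) = 𝟙 _ := by
    intro i
    rw [← cancel_mono U₀.ι, Category.assoc, morphismRestrict_ι, ← Category.assoc, hσ₀ι i,
      Category.assoc, hσ i, Category.comp_id, Category.id_comp]
  have hdisj : Pairwise fun i j => Disjoint (Set.range (σ₀ i)) (Set.range (σ₀ j)) := by
    intro i j hij
    refine Set.disjoint_left.mpr ?_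
    rintro _ ⟨u, rfl⟩ ⟨u', hu'⟩
    have h1 : (U₀.ι ≫ σ j) u' = (U₀.ι ≫ σ i) u := by
      rw [← hσ₀ι i, ← hσ₀ι j, Scheme.Hom.comp_apply, Scheme.Hom.comp_apply, hu']
    have h2 : u' = u := by
      have h3 : f ((U₀.ι ≫ σ j) u') = f ((U₀.ι ≫ σ i) u) := by rw [h1]
      rw [← Scheme.Hom.comp_apply, ← Scheme.Hom.comp_apply, Category.assoc, Category.assoc,
        hσ i, hσ j, Category.comp_id] at h3
      exact U₀.ι.isOpenEmbedding.injective h3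
    subst h2
    rw [Scheme.Hom.comp_apply, Scheme.Hom.comp_apply] at h1
    exact hU₁ _ u'.2.2 i j hij h1.symm
  have hdim := topologicalKrullDim_irreducibleComponents_fiber_morphismRestrict f U₀
    hP.isCurveFibration.topologicalKrullDim_eq_one
  have hn : 3 ≤ n := by
    rw [hZ] at h3
    exact three_le_of_hasThreeSmoothPoints f hσ h3
  /- Step 2: the moduli input -/
  obtain ⟨M, gM, CM, q, τ, U', hU', e, m, X', p', a, b, ρ, hMproj, hCMproj, hq, he, hes, hee,
    hm, sqa, sqb, hρ⟩ :=
    h224 k (U₀.ι ≫ g) (f ∣_ U₀) hdim hn σ₀ hσ₀ hdisj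
  haveI := hU'
  haveI := he
  haveI := hes
  haveI : IsProper gM := Motives.IsProjectiveOver.isProper (X := Over.mk gM) hMproj
  /- Step 3: `N`, the normalization of `Y` in `U'` -/
  let jN : U' ⟶ (e ≫ U₀.ι).normalization := (e ≫ U₀.ι).toNormalization
  let ν : (e ≫ U₀.ι).normalization ⟶ Y := (e ≫ U₀.ι).fromNormalization
  have sqN : IsPullback jN e ν U₀.ι := isPullback_toNormalization_fromNormalization e U₀.ι
  haveI : IsOpenImmersion jN := isOpenImmersion_toNormalization e U₀.ι
  haveI : IsFinite ν := isFinite_fromNormalization_comp_ι U₀ e g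
  have hNproj : Motives.IsProjectiveOver (Over.mk (ν ≫ g)) :=
    isProjectiveOver_comp_of_isFinite ν g hP.isProjectiveOver_base
  /- Step 4: `Y'`, the closure of the graph of `m` in `N ×_k M̄` -/
  have hw : jN ≫ ν ≫ g = m ≫ gM := by
    rw [← Category.assoc, show jN ≫ ν = e ≫ U₀.ι from sqN.w, Category.assoc, hm]
  let γ : U' ⟶ pullback (ν ≫ g) gM := pullback.lift jN m hw
  haveI : IsLocallyNoetherian U' := LocallyOfFiniteType.isLocallyNoetherian (e ≫ U₀.ι ≫ g)
  haveI : CompactSpace U' := by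
    rw [← isCompact_univ_iff, ← Set.preimage_univ (f := e)]
    exact QuasiCompact.isCompact_preimage (f := e) _ isOpen_univ isCompact_univ
  haveI : IsNoetherian U' := ⟨⟩
  obtain ⟨Y', c, s, hY', hc, hsc, hs, hsdense, sqs⟩ :=
    exists_graphClosure_compactification jN (pullback.fst (ν ≫ g) gM) γ (pullback.lift_fst _ _ _)
  haveI := hY'
  haveI := hc
  haveI := hs
  let ψ : Y' ⟶ Y := (c ≫ pullback.fst (ν ≫ g) gM) ≫ ν
  let μ : Y' ⟶ M := c ≫ pullback.snd (ν ≫ g) gM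
  have hsμ : s ≫ μ = m := by
    show s ≫ c ≫ pullback.snd (ν ≫ g) gM = m
    rw [reassoc_of% hsc, pullback.lift_snd]
  have hμ : μ ≫ gM = ψ ≫ g := by
    show (c ≫ pullback.snd (ν ≫ g) gM) ≫ gM = ((c ≫ pullback.fst (ν ≫ g) gM) ≫ ν) ≫ g
    simp only [Category.assoc, ← pullback.condition]
  -- `ψ⁻¹(U₀) = U'`: the square `s, e, ψ, U₀ ↪ Y` is cartesian
  have sqψ : IsPullback s e ψ U₀.ι := by
    have := sqs.paste_vert sqN
    rwa [Category.id_comp] at this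
  have hsψ : s ≫ ψ = e ≫ U₀.ι := sqψ.w
  -- `Y'` is a projective variety
  have hPproj : Motives.IsProjectiveOver (Over.mk (pullback.snd (ν ≫ g) gM ≫ gM)) :=
    isProjectiveOver_pullback (ν ≫ g) (𝟙 _) gM gM (Category.comp_id _)
      (by simpa using hNproj) hMproj
  have hY'proj : Motives.IsProjectiveOver (Over.mk (ψ ≫ g)) := by
    let T : Motives.SchemeOver k := Over.mk (pullback.snd (ν ≫ g) gM ≫ gM)
    have hw' : c ≫ T.hom = (Over.mk (ψ ≫ g) : Motives.SchemeOver k).hom := by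
      show c ≫ pullback.snd (ν ≫ g) gM ≫ gM = ((c ≫ pullback.fst (ν ≫ g) gM) ≫ ν) ≫ g
      simp only [Category.assoc, ← pullback.condition]
    let ιc : (Over.mk (ψ ≫ g) : Motives.SchemeOver k) ⟶ T := Over.homMk c hw'
    haveI : IsClosedImmersion ιc.left := inferInstanceAs (IsClosedImmersion c)
    exact isProjectiveOver_of_isClosedImmersion_left ιc hPproj
  /- Step 5: `ψ` is a generically étale alteration -/
  have hψalt : IsAlteration ψ := by
    refine ⟨inferInstance, inferInstance, ?_, U₀, ⟨_, hηU₀⟩, ?_⟩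
    · -- dominant: the image contains `U₀`
      refine ⟨?_⟩
      have hsub : (U₀ : Set Y) ⊆ Set.range ψ := by
        intro y hy
        obtain ⟨u, hu⟩ := e.surjective ⟨y, hy⟩
        refine ⟨s u, ?_⟩
        rw [← Scheme.Hom.comp_apply, hsψ, Scheme.Hom.comp_apply, hu]
        rfl
      exact Dense.mono hsub (U₀.2.dense ⟨_, hηU₀⟩)
    · have hfin : IsFinite (ψ ∣_ U₀.ι.opensRange) :=
        morphismRestrict_opensRange_of_isPullback @IsFinite ψ U₀.ι e s sqψ he
      exact (MorphismProperty.arrow_mk_iso_iff @IsFinite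
        (morphismRestrictEq ψ U₀.opensRange_ι)).mp hfin
  have hψet : IsGenericallyEtale ψ := by
    obtain ⟨W, hWdense, hWet⟩ := hee
    refine ⟨s ''ᵁ W, ?_, ?_⟩
    · -- `s(W)` is dense: `W` is dense in `U'` and `s(U')` is dense in `Y'`
      have h1 : Set.range s ⊆ closure (s '' (W : Set U')) := by
        rw [← Set.image_univ, ← hWdense.closure_eq]
        exact image_closure_subset_closure_image s.continuous
      have h2 : Dense (s '' (W : Set U')) := by
        rw [dense_iff_closure_eq, ← Set.univ_subset_iff, ← hsdense.closure_eq]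
        exact closure_minimal h1 isClosed_closure
      simpa using h2
    · have e0 : (s ''ᵁ W).ι = (s.isoImage W).inv ≫ W.ι ≫ s := by
        rw [Iso.eq_inv_comp, Scheme.Hom.isoImage_hom_ι]
      have e1 : (s ''ᵁ W).ι ≫ ψ = ((s.isoImage W).inv ≫ (W.ι ≫ e)) ≫ U₀.ι := by
        rw [e0]
        simp only [Category.assoc, hsψ]
      rw [e1]
      haveI : Etale (W.ι ≫ e) := hWet
      infer_instance
  /- Step 6: the model `𝒞 ×_{M̄} Y'` -/
  let pC : pullback q μ ⟶ Y' := pullback.snd q μ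
  have hqC : IsPointedSemiStableCurve pC (PreSemiStablePair.pullbackSection hq.comp_eq_id μ) :=
    hq.baseChange μ
  -- the chart `X'` over `s : U' ↪ Y'`, as a pullback of the model …
  have hw₁ : b ≫ q = (p' ≫ s) ≫ μ := by rw [Category.assoc, hsμ, sqb.w]
  let w₁ : X' ⟶ pullback q μ := pullback.lift b (p' ≫ s) hw₁
  have sq₁ : IsPullback w₁ p' pC s := by
    refine IsPullback.of_right (h₁₂ := pullback.fst q μ) (v₁₃ := q) (h₂₂ := μ) ?_
      (pullback.lift_snd _ _ _) (IsPullback.of_hasPullback q μ)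
    rw [pullback.lift_fst, hsμ]
    exact sqb
  -- … and of `X ×_Y Y'`
  have bigX : IsPullback (a ≫ (f ⁻¹ᵁ U₀).ι) p' f (s ≫ ψ) := by
    rw [hsψ]
    exact sqa.paste_horiz (isPullback_morphismRestrict f U₀).flip
  let w₂ : X' ⟶ pullback f ψ := pullback.lift (a ≫ (f ⁻¹ᵁ U₀).ι) (p' ≫ s)
    (by rw [bigX.w, Category.assoc])
  have sq₂ : IsPullback w₂ p' (pullback.snd f ψ) s :=
    IsPullback.of_right (h₁₂ := pullback.fst f ψ) (v₁₃ := f) (h₂₂ := ψ)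
      (by rw [pullback.lift_fst]; exact bigX) (pullback.lift_snd _ _ _)
      (IsPullback.of_hasPullback f ψ)
  -- smoothness of the model over `U'`, hence of its generic fibre; integrality
  haveI : Smooth p' := MorphismProperty.of_isPullback sqa inferInstance
  haveI : Smooth (pC ∣_ s.opensRange) :=
    morphismRestrict_opensRange_of_isPullback @Smooth pC s p' w₁ sq₁ inferInstance
  have hηs : genericPoint Y' ∈ s.opensRange :=
    (genericPoint_spec Y').mem_open_set_iff s.opensRange.isOpen |>.mpr
      (by simpa using hsdense.nonempty)
  haveI : IsIntegral (pullback q μ) :=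
    DeJong1996SemiStableCurveNormalProof.isIntegral_of_isSemiStableCurve hqC.isSemiStableCurve
      (smooth_fiberToSpecResidueField_of_mem pC s.opensRange hηs)
  -- projectivity of the model
  haveI : IsSeparated gM := inferInstance
  have hCproj : Motives.IsProjectiveOver (Over.mk (pC ≫ ψ ≫ g)) :=
    isProjectiveOver_pullback q gM μ (ψ ≫ g) hμ hCMproj hY'proj
  /- Step 7: the sections and the chart -/
  have hρ₁ : ∀ i, ρ i ≫ w₁ = s ≫ PreSemiStablePair.pullbackSection hq.comp_eq_id μ i := by
    intro i
    obtain ⟨hρp, -, hρb⟩ := hρ i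
    apply pullback.hom_ext
    · rw [Category.assoc, pullback.lift_fst, hρb, Category.assoc,
        PreSemiStablePair.pullbackSection_fst, reassoc_of% hsμ]
    · rw [Category.assoc, pullback.lift_snd, reassoc_of% hρp, Category.assoc,
        PreSemiStablePair.pullbackSection_snd, Category.comp_id]
  have hρ₂ : ∀ i, ρ i ≫ w₂ = s ≫ PreSemiStablePair.pullbackSection hσ ψ i := by
    intro i
    obtain ⟨hρp, hρa, -⟩ := hρ i
    apply pullback.hom_ext
    · rw [Category.assoc, pullback.lift_fst, reassoc_of% hρa, hσ₀ι, Category.assoc,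
        PreSemiStablePair.pullbackSection_fst, reassoc_of% hsψ]
    · rw [Category.assoc, pullback.lift_snd, reassoc_of% hρp, Category.assoc,
        PreSemiStablePair.pullbackSection_snd, Category.comp_id]
  refine ⟨Y', hY', ψ, hY'proj, hψalt, hψet, ?_⟩
  exact HasPointedSemiStableModel.of_chart (f := pullback.snd f ψ) (g := ψ ≫ g)
    (by simpa [Category.assoc] using hCproj) hqC s p' w₁ w₂ sq₁ sq₂ ρ hρ₁ hρ₂

end Literature.AlgebraicGeometry.Resolution

end
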